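/-
Copyright (c) 2026 the pub-hodgecm-mathlib formalisation cell (harness21).  Prover seat hodgecm-mathlib-K2Liu-p01 (g3): Track B «K2-LIT»,
#184♮ = hLiu418 = stmt-HodgeConjecture-24832; socket #30s `sig_K2LiuThetaTypeDoublingEulerFactorGL1` of the tier-1 socket module
`Cruxes/HLiu418/Lines/K2_Liu_CurveThetaSigs_U5b_LocalSeam.lean` (ED. 4, sha16 6b9b43282eef5cf1, :336; planner K2Liu-plan (g1), LEAD F0P6-plan (g10)
GO + DEAL 2026-09-04T00:46:04Z, K2Liu-ref1 (g1) BOX #27 PASS); 2026-09-04.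
-/
import Summits.HodgeConjecture.HodgeConjecture.Theorems.K2LiuThetaTypePartialLPole
import Summits.HodgeConjecture.HodgeConjecture.Theorems.K2LiuHeckeEulerProductRegular
import Literature.NumberTheory.Automorphic.PairLFunctionBaseChange
import Literature.NumberTheory.Automorphic.UnitaryGroupLocalFactors
import Literature.NumberTheory.GelbartRogawski1991.DoubledUnitaryGlobalSplittingData
import HarnessLib

/-!
# Crux `HLiu418`, Track B road `K2_Liu`, unit U5b «LOCAL SEAM OF s23», socket #30s:
# the GL₁ shape of the unramified doubling Euler product — `∏'_{v∉S} c_v(s) = ζ^{S_L}_L(s+½)·L^{S_L}(s+½,ψ)·B^S(s)`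

Cell `hodgecm-mathlib`, crux item hLiu418 = `stmt-HodgeConjecture-24832`, route of record `HCCMUnconditional`; squad K2 ∕ K2Liu,
LEAD F0P6-plan (g10), planner K2Liu-plan (g1), prover K2Liu-p01 (g3).  THEOREMS ONLY (no `def`, no instance, no notation, no
named-fact hypothesis, no `sorry`, default heartbeats); lane `--supports stmt-HodgeConjecture-24832` (count-neutral helper).

WHAT IS PROVED.  `thetaTypeDoublingEulerFactorGL1` — statement bytes = the socket
`Summit.HodgeConjecture.HodgeConjecture.Cruxes.HLiu418.K2LiuCurveThetaSigsU5bLocalSeam.sig_K2LiuThetaTypeDoublingEulerFactorGL1`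
VERBATIM (organ (LS2)(d), the consumer that pins `c`).  `L` CM with `L⁺ = Fp L`, `S` a finite set of finite places of `L⁺`, `ψ` a
unitary Hecke character of `L`, `θ₁, θ₂` coefficient families on the places of `L⁺` bounded by `1`, `c_v(s)` any functions with
 (H) `c_v(s) · ∏_{w∣v} (1 − q_w^{−(s+½)})(1 − ψ_w(ϖ_w) q_w^{−(s+½)}) = (1 − θ₁(v) q_v^{−(2s+2)})(1 − θ₂(v) q_v^{−(2s+1)}) =: B_v(s)`
for `v ∉ S`, `Re s > 0`.  THEN (i) `B^S(s) := ∏'_{v∉S} B_v(s)` is holomorphic and zero-free on `Re s > 0`; (ii) for `Re s > 1`,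
`v ↦ c_v(s)` (`v ∉ S`) is multipliable and `∏'_{v∉S} c_v(s) = (∏'_{w∉S_L} (1 − q_w^{−(s+½)})⁻¹(1 − ψ_w(ϖ_w)q_w^{−(s+½)})⁻¹) · B^S(s)`,
`S_L := {w ∣ w ∩ 𝓞L⁺ ∈ S}` [Liu2021, proof of Lem. D.1 p. 126 L8–13: at a split place `BC(π_w) ⊗ χ_{D,w}` has Satake parameters
`{1, ψ_w(ϖ_w)}`; the `b_2`-normalisation is Li1992 (3) ∕ Liu2011 (2-4)].

PROOF (pure GL₁ ∕ `tprod` bookkeeping).  §1 `‖a q_v^{−z}‖ ≤ q_v^{−Re z} < 1` (`‖a‖ ≤ 1`, `Re z > 0`), so `1 − a q_v^{−z} ≠ 0`, and the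
Weierstrass majorant `‖B_v(s) − 1‖ ≤ 3 q_v^{−(2σ₀+1)}` (`0 < σ₀ ≤ Re s`), summable by ★ `summable_residueCard_rpow_neg`.  §2 the
`M`-test (Mathlib `Summable.hasProdLocallyUniformlyOn_one_add`) ⇒ locally uniform convergence of `∏ B_v` on `Re s > σ₀`, holomorphy
(`TendstoLocallyUniformlyOn.differentiableOn`) on every `{Re s > σ₀}` hence on `{Re s > 0}`, no zeros (`tprod_one_add_ne_zero_of_summable`)
— ★ #1's engine `K2LiuHeckeEulerProductRegular` re-run on the non-inverted factors [NeukirchANT1999, VII (8.1)].  §3 the `w`-side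
`∏'_{w∉T}(1 − q_w^{−u})⁻¹(1 − ψ_w(ϖ_w)q_w^{−u})⁻¹` has a genuine `HasProd` for `Re u > 1` (★ `multipliable_inv_one_sub_residueCard_cpow_neg`,
★ `K2LiuThetaTypePartialLPole.multipliable_inv_one_sub_valueAtUniformizer_mul_cpow`), regrouped by the place below along
`Σ_{v∉S} {w ∣ v} ≃ {w ∣ w ∩ 𝓞L⁺ ∉ S}` (the tree's ★ `placesNotOverEquivSigma` re-spelled on the socket's index types; Mathlib
`Equiv.hasProd_iff` + `HasProd.sigma`, fibres finite ★ `instFintypePlacesOver`) [ArthurClozelAMS120, Ch. 3 Lem. 4.3].  §4 from (H) and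
`E_v ≠ 0`: `c_v = (∏ᶠ_{w∣v} e_w⁻¹)·B_v` (`finprod_inv_distrib`, `mul_inv`); `HasProd.mul` of §3 at `u = s + ½` and §2 gives (ii).

HONEST LABEL.  Count-neutral scaffold file of the K2_Liu road; it retires socket #30s, not hLiu418: `HC_CM` is proved only modulo
the 7 printed citations (2 remaining named inputs: hLiu418 = `stmt-HodgeConjecture-24832`, h413 = `stmt-HodgeConjecture-24833`)
until rung 0 closes.

## References
* [Liu2021] Y. Liu, *Fourier–Jacobi cycles and arithmetic relative trace formula*, Camb. J. Math. 9 (2021): App. D, proof of Lem. D.1 p. 126.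
* [NeukirchANT1999] J. Neukirch, *Algebraic Number Theory*, Grundlehren 322 (1999): Ch. VII Prop. (8.1).
* [ArthurClozelAMS120] J. Arthur, L. Clozel, *Simple algebras, base change, and the advanced theory of the trace formula* (1989): Ch. 3 Lem. 4.3.
* [Li1992] J.-S. Li, *Non-vanishing theorems for the cohomology of certain arithmetic quotients*, Crelle 428 (1992): §3 Thm. 3.1.
* [Liu2011] Y. Liu, *Arithmetic theta lifting and L-derivatives for unitary groups I*, Algebra Number Theory 5 (2011): §2B (2-4).
-/

noncomputable section

open scoped Topology
open NumberField IsDedekindDomain Filter Complex Set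
open Literature.NumberTheory.Automorphic Literature.NumberTheory.GaloisRepresentations
open Literature.NumberTheory.GelbartRogawski1991 Literature.NumberTheory.GelbartRogawski1991.GRConstruction

namespace Summit.HodgeConjecture.HodgeConjecture.Cruxes.HLiu418.K2LiuThetaTypeDoublingEulerFactorGL1

variable {K : Type} [Field K] [NumberField K]

/-! ## §1  Local factors with bounded coefficients -/

/-- `‖a · q_v^{−z}‖ ≤ q_v^{−Re z}` for `‖a‖ ≤ 1` (`‖q_v^{−z}‖ = q_v^{−Re z}`). [folklore] -/
theorem norm_mul_cpow_neg_le {a : ℂ} (ha : ‖a‖ ≤ 1) (v : HeightOneSpectrum (𝓞 K)) (z : ℂ) :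
    ‖a * (v.residueCard : ℂ) ^ (-z)‖ ≤ (v.residueCard : ℝ) ^ (-z.re) := by
  rw [norm_mul, norm_natCast_cpow_of_pos (lt_trans zero_lt_one v.one_lt_residueCard), neg_re]
  have h0 : 0 ≤ (v.residueCard : ℝ) ^ (-z.re) := Real.rpow_nonneg (Nat.cast_nonneg _) _
  calc ‖a‖ * (v.residueCard : ℝ) ^ (-z.re) ≤ 1 * (v.residueCard : ℝ) ^ (-z.re) :=
        mul_le_mul_of_nonneg_right ha h0
    _ = (v.residueCard : ℝ) ^ (-z.re) := one_mul _

/-- `q_v^{−σ} ≤ q_v^{−σ₀}` for `σ₀ ≤ σ` (`q_v > 1`). [folklore] -/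
theorem rpow_neg_le_rpow_neg (v : HeightOneSpectrum (𝓞 K)) {σ₀ σ : ℝ} (h : σ₀ ≤ σ) :
    (v.residueCard : ℝ) ^ (-σ) ≤ (v.residueCard : ℝ) ^ (-σ₀) :=
  Real.rpow_le_rpow_of_exponent_le (by exact_mod_cast (v.one_lt_residueCard).le) (neg_le_neg h)

/-- `q_v^{−σ} < 1` for `σ > 0` (`q_v > 1`). [folklore] -/
theorem rpow_neg_lt_one (v : HeightOneSpectrum (𝓞 K)) {σ : ℝ} (hσ : 0 < σ) :
    (v.residueCard : ℝ) ^ (-σ) < 1 :=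
  Real.rpow_lt_one_of_one_lt_of_neg (by exact_mod_cast v.one_lt_residueCard) (by linarith)

/-- `‖a · q_v^{−z}‖ < 1` for `‖a‖ ≤ 1`, `Re z > 0`. [folklore] -/
theorem norm_mul_cpow_neg_lt_one {a : ℂ} (ha : ‖a‖ ≤ 1) (v : HeightOneSpectrum (𝓞 K)) {z : ℂ}
    (hz : 0 < z.re) : ‖a * (v.residueCard : ℂ) ^ (-z)‖ < 1 :=
  (norm_mul_cpow_neg_le ha v z).trans_lt (rpow_neg_lt_one v hz)

/-- The local factor `1 − a q_v^{−z}` does not vanish for `‖a‖ ≤ 1`, `Re z > 0`. [folklore] -/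
theorem one_sub_mul_cpow_neg_ne_zero {a : ℂ} (ha : ‖a‖ ≤ 1) (v : HeightOneSpectrum (𝓞 K)) {z : ℂ}
    (hz : 0 < z.re) : 1 - a * (v.residueCard : ℂ) ^ (-z) ≠ 0 := by
  intro h
  have h1 : ‖a * (v.residueCard : ℂ) ^ (-z)‖ = 1 := by
    rw [sub_eq_zero] at h
    rw [← h, norm_one]
  exact (norm_mul_cpow_neg_lt_one ha v hz).ne h1

/-- The zeta local factor `1 − q_v^{−z}` does not vanish for `Re z > 0`. [folklore] -/
theorem one_sub_cpow_neg_ne_zero (v : HeightOneSpectrum (𝓞 K)) {z : ℂ} (hz : 0 < z.re) :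
    1 - (v.residueCard : ℂ) ^ (-z) ≠ 0 := by
  have h := one_sub_mul_cpow_neg_ne_zero (a := 1) (by rw [norm_one]) v hz
  rwa [one_mul] at h

/-- `Re (2s + 2) = 2 Re s + 2`. [folklore] -/
theorem re_two_mul_add_two (s : ℂ) : (2 * s + 2 : ℂ).re = 2 * s.re + 2 := by
  simp [Complex.mul_re]

/-- `Re (2s + 1) = 2 Re s + 1`. [folklore] -/
theorem re_two_mul_add_one (s : ℂ) : (2 * s + 1 : ℂ).re = 2 * s.re + 1 := by
  simp [Complex.mul_re]

/-- `Re (s + ½) = Re s + ½`. [folklore] -/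
theorem re_add_half (s : ℂ) : (s + 1 / 2 : ℂ).re = s.re + 1 / 2 := by
  simp [Complex.add_re]

/-- **The Weierstrass majorant for the normalising factor** `B_v(s) = (1 − a q_v^{−(2s+2)})(1 − b q_v^{−(2s+1)})`:
`‖B_v(s) − 1‖ ≤ 3 q_v^{−(2σ₀+1)}` for `‖a‖, ‖b‖ ≤ 1` and `0 < σ₀ ≤ Re s`
(`(1−x)(1−y) − 1 = −x − y + xy`, `‖x‖ ≤ 1`, `‖x‖, ‖y‖ ≤ q_v^{−(2σ₀+1)}`). [cite: NeukirchANT1999, Ch. VII Prop. (8.1)] -/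
theorem norm_bFactor_sub_one_le {a b : ℂ} (ha : ‖a‖ ≤ 1) (hb : ‖b‖ ≤ 1) (v : HeightOneSpectrum (𝓞 K))
    {σ₀ : ℝ} (hσ₀ : 0 < σ₀) {s : ℂ} (hs : σ₀ ≤ s.re) :
    ‖(1 - a * (v.residueCard : ℂ) ^ (-(2 * s + 2))) * (1 - b * (v.residueCard : ℂ) ^ (-(2 * s + 1))) - 1‖ ≤
      3 * (v.residueCard : ℝ) ^ (-(2 * σ₀ + 1)) := by
  set x : ℂ := a * (v.residueCard : ℂ) ^ (-(2 * s + 2)) with hx_def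
  set y : ℂ := b * (v.residueCard : ℂ) ^ (-(2 * s + 1)) with hy_def
  have hx : ‖x‖ ≤ (v.residueCard : ℝ) ^ (-(2 * σ₀ + 1)) := by
    refine (norm_mul_cpow_neg_le ha v _).trans ?_
    rw [re_two_mul_add_two]
    exact rpow_neg_le_rpow_neg v (by linarith)
  have hy : ‖y‖ ≤ (v.residueCard : ℝ) ^ (-(2 * σ₀ + 1)) := by
    refine (norm_mul_cpow_neg_le hb v _).trans ?_
    rw [re_two_mul_add_one]
    exact rpow_neg_le_rpow_neg v (by linarith)
  have hx1 : ‖x‖ ≤ 1 :=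
    (norm_mul_cpow_neg_lt_one ha v (by rw [re_two_mul_add_two]; linarith)).le
  have hxy : (1 - x) * (1 - y) - 1 = -x - y + x * y := by ring
  rw [hxy]
  calc ‖-x - y + x * y‖ ≤ ‖-x - y‖ + ‖x * y‖ := norm_add_le _ _
    _ ≤ (‖x‖ + ‖y‖) + ‖x‖ * ‖y‖ := by
        gcongr
        · exact (norm_sub_le _ _).trans (by rw [norm_neg])
        · exact norm_mul_le _ _
    _ ≤ (‖x‖ + ‖y‖) + 1 * ‖y‖ := by gcongr
    _ ≤ 3 * (v.residueCard : ℝ) ^ (-(2 * σ₀ + 1)) := by linarith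

/-- The majorant `3 q_v^{−(2σ₀+1)}` is summable over the places `v ∉ S` for `σ₀ > 0` (convergence of `ζ_K(2σ₀+1)`,
★ `summable_residueCard_rpow_neg`). [cite: NeukirchANT1999, Ch. VII Prop. (8.1)] -/
theorem summable_bMajorant (S : Finset (HeightOneSpectrum (𝓞 K))) {σ₀ : ℝ} (hσ₀ : 0 < σ₀) :
    Summable fun v : {v : HeightOneSpectrum (𝓞 K) // v ∉ S} =>
      3 * (v.1.residueCard : ℝ) ^ (-(2 * σ₀ + 1)) := by
  refine Summable.mul_left 3 ?_
  exact (summable_residueCard_rpow_neg (K := K) (show (1 : ℝ) < 2 * σ₀ + 1 by linarith)).comp_injective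
    Subtype.val_injective

/-- Each normalising factor `s ↦ B_v(s)` is entire (`q_v ≠ 0`). [folklore] -/
theorem differentiable_bFactor (a b : ℂ) (v : HeightOneSpectrum (𝓞 K)) :
    Differentiable ℂ fun s : ℂ =>
      (1 - a * (v.residueCard : ℂ) ^ (-(2 * s + 2))) * (1 - b * (v.residueCard : ℂ) ^ (-(2 * s + 1))) := by
  have hq : (v.residueCard : ℂ) ≠ 0 :=
    Nat.cast_ne_zero.mpr (by have := v.one_lt_residueCard; omega)
  have h2 : Differentiable ℂ fun s : ℂ => (v.residueCard : ℂ) ^ (-(2 * s + 2)) :=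
    (((differentiable_id.const_mul (2 : ℂ)).add_const (2 : ℂ)).neg).const_cpow (Or.inl hq)
  have h1 : Differentiable ℂ fun s : ℂ => (v.residueCard : ℂ) ^ (-(2 * s + 1)) :=
    (((differentiable_id.const_mul (2 : ℂ)).add_const (1 : ℂ)).neg).const_cpow (Or.inl hq)
  exact ((differentiable_const _).sub ((differentiable_const _).mul h2)).mul
    ((differentiable_const _).sub ((differentiable_const _).mul h1))

/-! ## §2  The normalising product `B^S`: locally uniform convergence, holomorphy, no zeros on `Re s > 0` -/

section BProduct

variable {θ₁ θ₂ : HeightOneSpectrum (𝓞 K) → ℂ}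

/-- **Locally uniform convergence of `B^S` on `Re s > σ₀`** (`σ₀ > 0`): Weierstrass `M`-test with the majorant
`3 q_v^{−(2σ₀+1)}` (Mathlib `Summable.hasProdLocallyUniformlyOn_one_add`). [cite: NeukirchANT1999, Ch. VII Prop. (8.1)] -/
theorem hasProdLocallyUniformlyOn_bProduct (hθ₁ : ∀ v, ‖θ₁ v‖ ≤ 1) (hθ₂ : ∀ v, ‖θ₂ v‖ ≤ 1)
    (S : Finset (HeightOneSpectrum (𝓞 K))) {σ₀ : ℝ} (hσ₀ : 0 < σ₀) :
    HasProdLocallyUniformlyOn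
      (fun (v : {v : HeightOneSpectrum (𝓞 K) // v ∉ S}) (s : ℂ) =>
        ((1 - θ₁ v.1 * (v.1.residueCard : ℂ) ^ (-(2 * s + 2))) *
          (1 - θ₂ v.1 * (v.1.residueCard : ℂ) ^ (-(2 * s + 1)))))
      (fun s : ℂ => ∏' v : {v : HeightOneSpectrum (𝓞 K) // v ∉ S},
        ((1 - θ₁ v.1 * (v.1.residueCard : ℂ) ^ (-(2 * s + 2))) *
          (1 - θ₂ v.1 * (v.1.residueCard : ℂ) ^ (-(2 * s + 1)))))
      {s : ℂ | σ₀ < s.re} := by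
  have hopen : IsOpen {s : ℂ | σ₀ < s.re} := isOpen_lt continuous_const Complex.continuous_re
  have h := Summable.hasProdLocallyUniformlyOn_one_add (K := {s : ℂ | σ₀ < s.re})
    (f := fun (v : {v : HeightOneSpectrum (𝓞 K) // v ∉ S}) (s : ℂ) =>
      ((1 - θ₁ v.1 * (v.1.residueCard : ℂ) ^ (-(2 * s + 2))) *
          (1 - θ₂ v.1 * (v.1.residueCard : ℂ) ^ (-(2 * s + 1)))) - 1)
    hopen (summable_bMajorant S hσ₀)
    (Filter.Eventually.of_forall fun v s hs =>
      norm_bFactor_sub_one_le (hθ₁ v.1) (hθ₂ v.1) v.1 hσ₀ (le_of_lt hs))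
    (fun v => (((differentiable_bFactor (θ₁ v.1) (θ₂ v.1) v.1).sub_const 1).continuous).continuousOn)
  simpa only [add_sub_cancel] using h

/-- `B^S` is holomorphic on `Re s > σ₀` for every `σ₀ > 0` (locally uniform limit of entire partial products, Mathlib
`TendstoLocallyUniformlyOn.differentiableOn`). [cite: NeukirchANT1999, Ch. VII Prop. (8.1)] -/
theorem differentiableOn_bProduct_of_lt (hθ₁ : ∀ v, ‖θ₁ v‖ ≤ 1) (hθ₂ : ∀ v, ‖θ₂ v‖ ≤ 1)
    (S : Finset (HeightOneSpectrum (𝓞 K))) {σ₀ : ℝ} (hσ₀ : 0 < σ₀) :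
    DifferentiableOn ℂ (fun s : ℂ => ∏' v : {v : HeightOneSpectrum (𝓞 K) // v ∉ S},
        ((1 - θ₁ v.1 * (v.1.residueCard : ℂ) ^ (-(2 * s + 2))) *
          (1 - θ₂ v.1 * (v.1.residueCard : ℂ) ^ (-(2 * s + 1))))) {s : ℂ | σ₀ < s.re} := by
  refine (hasProdLocallyUniformlyOn_iff_tendstoLocallyUniformlyOn.mp
    (hasProdLocallyUniformlyOn_bProduct hθ₁ hθ₂ S hσ₀)).differentiableOn
    (Filter.Eventually.of_forall fun T => ?_) (isOpen_lt continuous_const Complex.continuous_re)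
  refine DifferentiableOn.fun_finsetProd fun v _ => fun s _ => ?_
  exact ((differentiable_bFactor (θ₁ v.1) (θ₂ v.1) v.1) s).differentiableWithinAt

/-- **`B^S` is holomorphic on `Re s > 0`** (`{Re s > 0} = ⋃_{σ₀>0} {Re s > σ₀}`). [cite: NeukirchANT1999, Ch. VII Prop. (8.1)] -/
theorem differentiableOn_bProduct (hθ₁ : ∀ v, ‖θ₁ v‖ ≤ 1) (hθ₂ : ∀ v, ‖θ₂ v‖ ≤ 1)
    (S : Finset (HeightOneSpectrum (𝓞 K))) :
    DifferentiableOn ℂ (fun s : ℂ => ∏' v : {v : HeightOneSpectrum (𝓞 K) // v ∉ S},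
        ((1 - θ₁ v.1 * (v.1.residueCard : ℂ) ^ (-(2 * s + 2))) *
          (1 - θ₂ v.1 * (v.1.residueCard : ℂ) ^ (-(2 * s + 1))))) {s : ℂ | 0 < s.re} := by
  intro s hs
  have hs' : 0 < s.re := hs
  have hσ : 0 < s.re / 2 := by linarith
  have hmem : s ∈ {z : ℂ | s.re / 2 < z.re} := by
    show s.re / 2 < s.re
    linarith
  exact ((differentiableOn_bProduct_of_lt hθ₁ hθ₂ S hσ).differentiableAt
    ((isOpen_lt continuous_const Complex.continuous_re).mem_nhds hmem)).differentiableWithinAt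

/-- **`B^S(s) ≠ 0` for `Re s > 0`**: an absolutely convergent product of non-zero factors is non-zero (§1 and Mathlib
`tprod_one_add_ne_zero_of_summable`). [cite: NeukirchANT1999, Ch. VII Prop. (8.1)] -/
theorem bProduct_ne_zero (hθ₁ : ∀ v, ‖θ₁ v‖ ≤ 1) (hθ₂ : ∀ v, ‖θ₂ v‖ ≤ 1)
    (S : Finset (HeightOneSpectrum (𝓞 K))) {s : ℂ} (hs : 0 < s.re) :
    (∏' v : {v : HeightOneSpectrum (𝓞 K) // v ∉ S},
        ((1 - θ₁ v.1 * (v.1.residueCard : ℂ) ^ (-(2 * s + 2))) *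
          (1 - θ₂ v.1 * (v.1.residueCard : ℂ) ^ (-(2 * s + 1))))) ≠ 0 := by
  have hsum : Summable fun v : {v : HeightOneSpectrum (𝓞 K) // v ∉ S} =>
      ‖((1 - θ₁ v.1 * (v.1.residueCard : ℂ) ^ (-(2 * s + 2))) *
          (1 - θ₂ v.1 * (v.1.residueCard : ℂ) ^ (-(2 * s + 1)))) - 1‖ :=
    Summable.of_nonneg_of_le (fun _ => norm_nonneg _)
      (fun v => norm_bFactor_sub_one_le (hθ₁ v.1) (hθ₂ v.1) v.1 hs le_rfl)
      (summable_bMajorant S hs)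
  have hne : ∀ v : {v : HeightOneSpectrum (𝓞 K) // v ∉ S},
      1 + (((1 - θ₁ v.1 * (v.1.residueCard : ℂ) ^ (-(2 * s + 2))) *
          (1 - θ₂ v.1 * (v.1.residueCard : ℂ) ^ (-(2 * s + 1)))) - 1) ≠ 0 := by
    intro v
    rw [add_sub_cancel]
    exact mul_ne_zero
      (one_sub_mul_cpow_neg_ne_zero (hθ₁ v.1) v.1 (by rw [re_two_mul_add_two]; linarith))
      (one_sub_mul_cpow_neg_ne_zero (hθ₂ v.1) v.1 (by rw [re_two_mul_add_one]; linarith))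
  have h := tprod_one_add_ne_zero_of_summable hne hsum
  simp only [add_sub_cancel] at h
  exact h

/-- `B^S(s)` is the genuine `HasProd`-limit of its partial products at every `s` with `Re s > 0` (§2 at `σ₀ = Re s ∕ 2`). [folklore] -/
theorem hasProd_bProduct (hθ₁ : ∀ v, ‖θ₁ v‖ ≤ 1) (hθ₂ : ∀ v, ‖θ₂ v‖ ≤ 1)
    (S : Finset (HeightOneSpectrum (𝓞 K))) {s : ℂ} (hs : 0 < s.re) :
    HasProd (fun v : {v : HeightOneSpectrum (𝓞 K) // v ∉ S} =>
        ((1 - θ₁ v.1 * (v.1.residueCard : ℂ) ^ (-(2 * s + 2))) *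
          (1 - θ₂ v.1 * (v.1.residueCard : ℂ) ^ (-(2 * s + 1)))))
      (∏' v : {v : HeightOneSpectrum (𝓞 K) // v ∉ S},
        ((1 - θ₁ v.1 * (v.1.residueCard : ℂ) ^ (-(2 * s + 2))) *
          (1 - θ₂ v.1 * (v.1.residueCard : ℂ) ^ (-(2 * s + 1))))) := by
  have hσ : 0 < s.re / 2 := by linarith
  exact (hasProdLocallyUniformlyOn_bProduct hθ₁ hθ₂ S hσ).hasProd (show s.re / 2 < s.re by linarith)

end BProduct

/-! ## §3  The `w`-side: the partial GL₁ product of `L` and its regrouping by the place of `L⁺` below -/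

/-- **The partial GL₁ product `∏'_{w∉T} (1 − q_w^{−u})⁻¹(1 − ψ_w(ϖ_w) q_w^{−u})⁻¹` converges for `Re u > 1`** (genuine `HasProd`;
★ `multipliable_inv_one_sub_residueCard_cpow_neg` times ★ `multipliable_inv_one_sub_valueAtUniformizer_mul_cpow`, Mathlib
`Multipliable.mul`). [cite: NeukirchANT1999, Ch. VII Prop. (8.1)] -/
theorem hasProd_zetaHeckeFactor {L : Type} [Field L] [NumberField L] {ψ : HeckeCharacter L} (hψ : ψ.IsUnitary)
    (T : Set (HeightOneSpectrum (𝓞 L))) {u : ℂ} (hu : 1 < u.re) :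
    HasProd (fun w : {w : HeightOneSpectrum (𝓞 L) // w ∉ T} =>
        ((1 - ((w.1.residueCard : ℂ) ^ (-u)))⁻¹ *
          (1 - ψ.valueAtUniformizer w.1 * ((w.1.residueCard : ℂ) ^ (-u)))⁻¹))
      (∏' w : {w : HeightOneSpectrum (𝓞 L) // w ∉ T},
        ((1 - ((w.1.residueCard : ℂ) ^ (-u)))⁻¹ *
          (1 - ψ.valueAtUniformizer w.1 * ((w.1.residueCard : ℂ) ^ (-u)))⁻¹)) :=
  ((multipliable_inv_one_sub_residueCard_cpow_neg T hu).mul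
    (K2LiuThetaTypePartialLPole.multipliable_inv_one_sub_valueAtUniformizer_mul_cpow hψ T hu)).hasProd

/-- **Regrouping by the place below** [Arthur–Clozel, Ch. 3 Lem. 4.3 bookkeeping]: for a CM field `L` with maximal real subfield
`L⁺ = Fp L`, a finite set `S` of places of `L⁺` and `Re u > 1`, the family `v ↦ ∏_{w∣v} (1 − q_w^{−u})⁻¹(1 − ψ_w(ϖ_w)q_w^{−u})⁻¹`
(`v ∉ S`) has `HasProd`-limit `∏'_{w ∉ S_L} (1 − q_w^{−u})⁻¹(1 − ψ_w(ϖ_w)q_w^{−u})⁻¹`, `S_L = {w ∣ w ∩ 𝓞L⁺ ∈ S}` — transport along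
the equivalence `Σ_{v∉S} {w ∣ v} ≃ {w ∣ w ∩ 𝓞L⁺ ∉ S}` (the tree's ★ `placesNotOverEquivSigma` on the socket's index types; Mathlib
`Equiv.hasProd_iff`, `HasProd.sigma`; the fibres are finite, ★ `instFintypePlacesOver`). [cite: ArthurClozelAMS120, Ch. 3 Lem. 4.3] -/
theorem hasProd_finprod_placesOver_zetaHeckeFactor (L : Type) [Field L] [NumberField L] [IsCMField L]
    (S : Finset (HeightOneSpectrum (𝓞 (Fp L)))) {ψ : HeckeCharacter L} (hψ : ψ.IsUnitary) {u : ℂ} (hu : 1 < u.re) :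
    HasProd (fun v : {v : HeightOneSpectrum (𝓞 (Fp L)) // v ∉ S} =>
        ∏ᶠ w : UnitaryGroup.PlacesOver L v.1,
          ((1 - ((w.1.residueCard : ℂ) ^ (-u)))⁻¹ *
            (1 - ψ.valueAtUniformizer w.1 * ((w.1.residueCard : ℂ) ^ (-u)))⁻¹))
      (∏' w : {w : HeightOneSpectrum (𝓞 L) // w ∉ {w : HeightOneSpectrum (𝓞 L) | w.under (𝓞 (Fp L)) ∈ S}},
        ((1 - ((w.1.residueCard : ℂ) ^ (-u)))⁻¹ *
          (1 - ψ.valueAtUniformizer w.1 * ((w.1.residueCard : ℂ) ^ (-u)))⁻¹)) := by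
  -- the local factors on the places of `L` off `S_L`
  set X : {w : HeightOneSpectrum (𝓞 L) // w ∉ {w : HeightOneSpectrum (𝓞 L) | w.under (𝓞 (Fp L)) ∈ S}} → ℂ :=
    fun w => ((1 - ((w.1.residueCard : ℂ) ^ (-u)))⁻¹ *
      (1 - ψ.valueAtUniformizer w.1 * ((w.1.residueCard : ℂ) ^ (-u)))⁻¹) with hX
  have hXp : HasProd X (∏' w, X w) := hasProd_zetaHeckeFactor hψ _ hu
  -- the bookkeeping equivalence `Σ_{v ∉ S} {w ∣ v} ≃ {w ∣ w ∩ 𝓞L⁺ ∉ S}` (★ `placesNotOverEquivSigma`, socket index types)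
  set e : (Σ v : {v : HeightOneSpectrum (𝓞 (Fp L)) // v ∉ S}, UnitaryGroup.PlacesOver L v.1) ≃
      {w : HeightOneSpectrum (𝓞 L) // w ∉ {w : HeightOneSpectrum (𝓞 L) | w.under (𝓞 (Fp L)) ∈ S}} :=
    { toFun := fun p => ⟨p.2.1, fun h => p.1.2 (by
        have h' : p.2.1.under (𝓞 (Fp L)) ∈ S := h
        rwa [p.2.2] at h')⟩
      invFun := fun w => ⟨⟨w.1.under (𝓞 (Fp L)), w.2⟩, ⟨w.1, rfl⟩⟩
      left_inv := fun p => Sigma.subtype_ext (Subtype.ext p.2.2) rfl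
      right_inv := fun _ => rfl } with he
  have hXe : HasProd (X ∘ e) (∏' w, X w) := (Equiv.hasProd_iff e).2 hXp
  have hfib : ∀ v : {v : HeightOneSpectrum (𝓞 (Fp L)) // v ∉ S},
      HasProd (fun c : UnitaryGroup.PlacesOver L v.1 => (X ∘ e) ⟨v, c⟩)
        (∏ᶠ w : UnitaryGroup.PlacesOver L v.1,
          ((1 - ((w.1.residueCard : ℂ) ^ (-u)))⁻¹ *
            (1 - ψ.valueAtUniformizer w.1 * ((w.1.residueCard : ℂ) ^ (-u)))⁻¹)) := by
    intro v
    -- `(X ∘ e) ⟨v, c⟩` is the local factor at `c.1` by `rfl`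
    show HasProd (fun w : UnitaryGroup.PlacesOver L v.1 =>
      ((1 - ((w.1.residueCard : ℂ) ^ (-u)))⁻¹ *
        (1 - ψ.valueAtUniformizer w.1 * ((w.1.residueCard : ℂ) ^ (-u)))⁻¹)) _
    rw [finprod_eq_prod_of_fintype]
    exact hasProd_fintype _
  exact hXe.sigma hfib

/-! ## §4  The head -/

/-- **PAYMENT OF socket #30s `sig_K2LiuThetaTypeDoublingEulerFactorGL1`** (organ (LS2)(d) «GL₁ SHAPE OF THE UNRAMIFIED EULER PRODUCT»,
unit U5b «LOCAL SEAM OF s23» of the K2_Liu road; statement VERBATIM).  For a CM field `L` (`L⁺ = Fp L`), a finite set `S` of finite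
places of `L⁺`, a unitary Hecke character `ψ` of `L`, coefficient families `θ₁, θ₂` on the places of `L⁺` bounded by `1`, and
functions `c_v(s)` satisfying the cleared per-place identity (H) `c_v(s)·∏_{w∣v}(1 − q_w^{−(s+½)})(1 − ψ_w(ϖ_w)q_w^{−(s+½)}) =
(1 − θ₁(v)q_v^{−(2s+2)})(1 − θ₂(v)q_v^{−(2s+1)})` for `v ∉ S`, `Re s > 0` [Liu2021, proof of Lem. D.1 p. 126 L8–13: at a split
place the Satake parameters of `BC(π_w) ⊗ χ_{D,w}` are `{1, ψ_w(ϖ_w)}`; Li1992 Thm. 3.1 ∕ Liu2011 (2-4) for the normalising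
`b_2`-factor]: (i) `B^S(s) = ∏'_{v∉S}(1 − θ₁(v)q_v^{−(2s+2)})(1 − θ₂(v)q_v^{−(2s+1)})` is holomorphic and zero-free on `Re s > 0`
(§2); (ii) for `Re s > 1` the family `v ↦ c_v(s)` is multipliable and `∏'_{v∉S} c_v(s) = (∏'_{w∉S_L}(1 − q_w^{−(s+½)})⁻¹
(1 − ψ_w(ϖ_w)q_w^{−(s+½)})⁻¹)·B^S(s)`, `S_L = {w ∣ w ∩ 𝓞L⁺ ∈ S}` (§3 regrouping at `u = s + ½` times §2, `HasProd.mul`; from (H),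
`c_v = (∏ᶠ_{w∣v} e_w⁻¹)·B_v` since the finite product `E_v` of the non-zero `e_w` is non-zero).
[cite: Liu2021, proof of Lem. D.1 p. 126 L8–13] [cite: ArthurClozelAMS120, Ch. 3 Lem. 4.3] [cite: NeukirchANT1999, Ch. VII Prop. (8.1)]
[cite: Li1992, §3 Thm. 3.1] [cite: Liu2011, §2B (2-4) p. 862] -/
theorem thetaTypeDoublingEulerFactorGL1 :
    ∀ (L : Type) [Field L] [NumberField L] [IsCMField L]
      (S : Finset (HeightOneSpectrum (𝓞 (Fp L))))
      (ψ : HeckeCharacter L) (_hψ : ψ.IsUnitary)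
      (θ₁ θ₂ : HeightOneSpectrum (𝓞 (Fp L)) → ℂ) (_hθ₁ : ∀ v, ‖θ₁ v‖ ≤ 1) (_hθ₂ : ∀ v, ‖θ₂ v‖ ≤ 1)
      (c : HeightOneSpectrum (𝓞 (Fp L)) → ℂ → ℂ)
      -- (H) the per-place closed forms, cleared of denominators, over the fibre `{w ∣ v}`
      (_hc : ∀ v, v ∉ S → ∀ s : ℂ, 0 < s.re →
        c v s * ∏ᶠ w : UnitaryGroup.PlacesOver L v,
            ((1 - (w.1.residueCard : ℂ) ^ (-(s + 1 / 2))) *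
              (1 - ψ.valueAtUniformizer w.1 * (w.1.residueCard : ℂ) ^ (-(s + 1 / 2)))) =
          (1 - θ₁ v * (v.residueCard : ℂ) ^ (-(2 * s + 2))) *
            (1 - θ₂ v * (v.residueCard : ℂ) ^ (-(2 * s + 1)))),
      -- (i) the normalising product `B^S` is holomorphic and zero-free on `Re s > 0`
      DifferentiableOn ℂ (fun s : ℂ => ∏' v : {v : HeightOneSpectrum (𝓞 (Fp L)) // v ∉ S},
          ((1 - θ₁ v.1 * (v.1.residueCard : ℂ) ^ (-(2 * s + 2))) *
            (1 - θ₂ v.1 * (v.1.residueCard : ℂ) ^ (-(2 * s + 1))))) {s : ℂ | 0 < s.re} ∧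
      (∀ s : ℂ, 0 < s.re →
        (∏' v : {v : HeightOneSpectrum (𝓞 (Fp L)) // v ∉ S},
          ((1 - θ₁ v.1 * (v.1.residueCard : ℂ) ^ (-(2 * s + 2))) *
            (1 - θ₂ v.1 * (v.1.residueCard : ℂ) ^ (-(2 * s + 1))))) ≠ 0) ∧
      -- (ii) the Euler product of the `c_v` is the partial GL₁ product of `L` (BY VALUE, = rev. k `partialZetaL L ψ S_L (s + 1/2)`) times `B^S`
      ∀ s : ℂ, 1 < s.re →
        Multipliable (fun v : {v : HeightOneSpectrum (𝓞 (Fp L)) // v ∉ S} => c v.1 s) ∧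
        ∏' v : {v : HeightOneSpectrum (𝓞 (Fp L)) // v ∉ S}, c v.1 s =
          (∏' w : {w : HeightOneSpectrum (𝓞 L) // w ∉ {w : HeightOneSpectrum (𝓞 L) | w.under (𝓞 (Fp L)) ∈ S}},
              ((1 - ((w.1.residueCard : ℂ) ^ (-(s + 1 / 2))))⁻¹ *
                (1 - ψ.valueAtUniformizer w.1 * ((w.1.residueCard : ℂ) ^ (-(s + 1 / 2))))⁻¹)) *
            ∏' v : {v : HeightOneSpectrum (𝓞 (Fp L)) // v ∉ S},
              ((1 - θ₁ v.1 * (v.1.residueCard : ℂ) ^ (-(2 * s + 2))) *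
                (1 - θ₂ v.1 * (v.1.residueCard : ℂ) ^ (-(2 * s + 1)))) := by
  intro L _ _ _ S ψ hψ θ₁ θ₂ hθ₁ hθ₂ c hc
  refine ⟨differentiableOn_bProduct hθ₁ hθ₂ S, fun s hs => bProduct_ne_zero hθ₁ hθ₂ S hs, fun s hs => ?_⟩
  have hs0 : 0 < s.re := lt_trans zero_lt_one hs
  have hu : 1 < (s + 1 / 2 : ℂ).re := by rw [re_add_half]; linarith
  -- §3 at `u = s + ½` (the regrouped GL₁ product of `L`) times §2 (the normalising product `B^S(s)`)
  have hprod := (hasProd_finprod_placesOver_zetaHeckeFactor L S hψ hu).mul (hasProd_bProduct hθ₁ hθ₂ S hs0)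
  -- from (H): `c_v(s) = (∏ᶠ_{w∣v} e_w⁻¹) · B_v(s)` for `v ∉ S` (the finite product `E_v` of the non-zero `e_w` is non-zero)
  have hcv : ∀ v : {v : HeightOneSpectrum (𝓞 (Fp L)) // v ∉ S},
      c v.1 s =
        (∏ᶠ w : UnitaryGroup.PlacesOver L v.1,
          ((1 - ((w.1.residueCard : ℂ) ^ (-(s + 1 / 2))))⁻¹ *
            (1 - ψ.valueAtUniformizer w.1 * ((w.1.residueCard : ℂ) ^ (-(s + 1 / 2))))⁻¹)) *
        ((1 - θ₁ v.1 * (v.1.residueCard : ℂ) ^ (-(2 * s + 2))) *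
          (1 - θ₂ v.1 * (v.1.residueCard : ℂ) ^ (-(2 * s + 1)))) := by
    intro v
    have hE : (∏ᶠ w : UnitaryGroup.PlacesOver L v.1,
        ((1 - (w.1.residueCard : ℂ) ^ (-(s + 1 / 2))) *
          (1 - ψ.valueAtUniformizer w.1 * (w.1.residueCard : ℂ) ^ (-(s + 1 / 2))))) ≠ 0 := by
      rw [finprod_eq_prod_of_fintype, Finset.prod_ne_zero_iff]
      intro w _
      exact mul_ne_zero (one_sub_cpow_neg_ne_zero w.1 (lt_trans zero_lt_one hu))
        (one_sub_valueAtUniformizer_mul_cpow_ne_zero hψ w.1 (lt_trans zero_lt_one hu))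
    rw [(eq_mul_inv_iff_mul_eq₀ hE).2 (hc v.1 v.2 s hs0), mul_comm, ← finprod_inv_distrib]
    congr 1
    exact finprod_congr fun w => mul_inv _ _
  exact ⟨hprod.multipliable.congr fun v => (hcv v).symm, (tprod_congr hcv).trans hprod.tprod_eq⟩

end Summit.HodgeConjecture.HodgeConjecture.Cruxes.HLiu418.K2LiuThetaTypeDoublingEulerFactorGL1
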